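import Literature.MathematicalPhysics.QuantumLattice.XXZAntiferromagnetGroundStateUnique
import Literature.MathematicalPhysics.QuantumLattice.HardCoreBosonCheckerboardSolid
import Literature.MathematicalPhysics.QuantumLattice.MagneticHubbardTorusGauge
import HarnessLib

/-!
# The hard-core lattice Bose gas WITH nearest-neighbour repulsion: unique ground state at half
# filling and the Anderson tower (obscured `U(1)` breaking) — Koma–Tasaki 1994 §3.3 beyond `V = 0`

Topic `MathematicalPhysics/QuantumLattice`; family `hubbard` (cell `hubbard-cq`, transfer source «hard-core
boson / XXZ»). Companion of `HardCoreBosonGroundStateUnique.lean` (the hopping-only gas,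
Aizenman–Lieb–Seiringer–Solovej–Yngvason App. A), `AndersonTowerOfStatesUnconditional.lean`
(`hardCoreBoson_andersonTower_holds`, `V = 0`), `HardCoreBosonCheckerboardSolid.lean` (the model
`hamiltonianNN L t V = Σ_⟨xy⟩[-t(a†_xa_y + h.c.) + V(n_x-½)(n_y-½)] = xxzHamiltonian 1 (torusGraph d L) (-2t) (-V/2t)`,
Matsubara–Matsuda) and `XXZAntiferromagnetGroundStateUnique.lean` (the XXZ ANTIferromagnet `J > 0`, `Δ > 0`:
unique ground state, `Sᶻ_tot Φ = 0`, Koma–Tasaki's tower for `0 < Δ ≤ 1`).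

Koma–Tasaki [KomaTasaki1994] §3.3 discuss the hard-core Bose gas with pure hopping: «Let `Φ` be the unique ground state
of the Hamiltonian with the particle number equal to `N = L^d/2` … the condition of the long range order holds …
the absence of explicit symmetry breaking is manifest since the state has a fixed particle number. We see that there
is an "obscured symmetry breaking"», and apply their Theorems 2.1/2.2 (the tower `E_M - E_0 ≤ c₃M²/|Λ|` in the
particle-number sectors `|Λ|/2 + M`, Corollary 2.11). This file extends the tree's `V = 0` statements to the
INTERACTING gas, nearest-neighbour repulsion `V > 0` at the particle–hole symmetric chemical potential:

* §1 (`namespace Matrix`, abstract): unitary conjugation `A ↦ R A Rᴴ` transports ground spaces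
  (`Matrix.groundSpace_unitary_conj`), the ground-state degeneracy and `HasUniqueGroundState`
  (`Matrix.hasUniqueGroundState_unitary_conj_iff`).
* §2 (`namespace XXZKT`): **Dyson–Lieb–Simon's sublattice half-turn about the `3`-axis** on the even torus is a
  unitary `R` with `R Sᶻ_x Rᴴ = Sᶻ_x` and `R H_XXZ(J, Δ) Rᴴ = H_XXZ(-J, -Δ)`
  (`exists_sublatticeRotZ_conj_xxzHamiltonian`; every spin `n/2`, every `d`), hence it preserves the
  magnetisation sectors: `lowestEnergyInSector` and `groundEnergy` of `H_XXZ(-J,-Δ)` and `H_XXZ(J,Δ)` coincide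
  (`lowestEnergyInSector_xxz_neg_neg`, `groundEnergy_xxz_neg_neg`), and the planar-FERROMAGNETIC, axially
  antiferromagnetic model `J < 0`, `Δ < 0` inherits from the antiferromagnet `(-J, -Δ)`: a unique ground state
  (`hasUniqueGroundState_xxz_planarFerro`) lying in `Sᶻ_tot = 0` (`groundState_totalSpin_eq_zero_xxz_planarFerro`)
  and, for `-1 ≤ Δ < 0`, the Anderson tower (`xxzPlanarFerro_andersonTower_holds`, `d ≥ 2`, `(d, S) ≠ (2, ½)`).
* §3 (`namespace HardCoreBoson`, spin `½`): **the interacting hard-core Bose gas** `hamiltonianNN L t V`, `t > 0`,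
  `V > 0`, even torus `(ℤ/Lℤ)^d`, `d ≥ 1`: the ground state is unique (`hasUniqueGroundState_hamiltonianNN`) and has
  exactly `|Λ|/2` particles (`groundState_halfFilling_hamiltonianNN`; the `V = 0` case is the tree's
  `hasUniqueGroundState_hardCoreLatticeGas` / `groundState_halfFilling`); and the tower of particle-number sectors
  `E(|Λ|/2 + M) - E₀ ≤ c₃M²/|Λ|` for `M² ≤ c₂|Λ|` on all large even tori holds for `d ≥ 3`, `0 < V ≤ 2t`
  (`andersonTower_hamiltonianNN`) and for `d = 2`, `0 < V ≤ 0.3t` (`andersonTower_hamiltonianNN_two`, the tree's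
  certified planar window) — obscured `U(1)` (particle-number) symmetry breaking of the interacting lattice Bose gas.

WHAT THIS IS NOT: no statement about the Hubbard model or about soft-core bosons; `d = 2` beyond `V ≤ 0.3t` and the
Heisenberg point `V = 2t` in `d = 2` (spin-½ square-lattice antiferromagnet) are not covered (no ground-state
long-range order in print); `V < 0` (attraction: the planar FERRO/axial FERRO model is not reflection positive in
the needed form) is not treated. No `sorry`, no definition, no named fact.

## Mathlib / tree search

`lean search 'hasUniqueGroundState.*hamiltonianNN|hamiltonianNN.*unique|planarFerro|xxz_neg_neg|groundSpace_unitary_conj'`: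
nothing; the tree has the `V = 0` uniqueness (`HardCoreBoson.hasUniqueGroundState_hardCoreLatticeGas`) and tower
(`hardCoreBoson_andersonTower_holds`), the dictionary `HardCoreBoson.hamiltonianNN_eq_xxzHamiltonian`, the rotation
`sublatticeOpZ_conj_anisotropicTorus` / `exists_halfTurn_z`, sector energies under unitaries
`Matrix.minEnergyOn_conjTranspose_mul_mul`, and `Matrix.groundEnergy_unitary_conj`; a `HasUniqueGroundState`
transport exists only as a private lemma of `GroundStateReflectionPositivityHeisenberg`.

## References

* [KomaTasaki1994] T. Koma, H. Tasaki, *Symmetry breaking and finite-size effects in quantum many-body systems*,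
  J. Stat. Phys. 76 (1994) 745–803, §3.3 (hard-core Bose gas), Corollary 2.11, §3.2 (3.3).
* [AizenmanEtAl2004] M. Aizenman, E. H. Lieb, R. Seiringer, J. P. Solovej, J. Yngvason, Phys. Rev. A 70 (2004)
  023612, §II and Appendix A (unique ground state at half filling).
* [MatsubaraMatsuda1956] T. Matsubara, H. Matsuda, Prog. Theor. Phys. 16 (1956) 569–582, §2.
* [DysonLiebSimon1978] F. J. Dyson, E. H. Lieb, B. Simon, J. Stat. Phys. 18 (1978) 335–383, §2 (sublattice rotation).
* [BjornbergUeltschi2022] J. E. Björnberg, D. Ueltschi, arXiv:2204.12896, Prop. 2.4 (frame changes).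
* [Tasaki2019Tower] H. Tasaki, J. Stat. Phys. 174 (2019) 735–761, Corollary 3.2.
* [KuboKishi1988] K. Kubo, T. Kishi, Phys. Rev. Lett. 61 (1988) 2585.
* [Tasaki2020] H. Tasaki, *Physics and Mathematics of Quantum Many-Body Systems*, Springer GTP (2020), §2.1, App. A.2.
-/

noncomputable section

open Matrix Complex Finset
open scoped ComplexOrder

/-! ## §1 Unitary conjugation transports ground spaces and the ground-state degeneracy -/

namespace Matrix

variable {m : Type*} [Fintype m] [DecidableEq m]

/-- Ground states go to ground states: `ψ ∈ ker(A - E₀)` ⇒ `Rψ ∈ ker(RARᴴ - E₀)` (`R` unitary; the spectrum,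
hence `E₀`, is invariant). [cite: Tasaki2020, App. A.2] -/
theorem mulVec_mem_groundSpace_unitary_conj [Nonempty m] {A R : Matrix m m ℂ} (hR : R * Rᴴ = 1)
    (hR' : Rᴴ * R = 1) {ψ : m → ℂ} (hψ : ψ ∈ A.groundSpace) : R *ᵥ ψ ∈ (R * A * Rᴴ).groundSpace := by
  have hU : R ∈ Matrix.unitaryGroup m ℂ :=
    Matrix.mem_unitaryGroup_iff.2 (by rw [star_eq_conjTranspose]; exact hR)
  rw [mem_groundSpace_iff] at hψ ⊢
  rw [groundEnergy_unitary_conj hU, mulVec_mulVec, Matrix.mul_assoc (R * A), hR', Matrix.mul_one,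
    ← mulVec_mulVec, hψ, mulVec_smul]

/-- `Rᴴ (R A Rᴴ) R = A` for unitary `R`. [cite: Tasaki2020, App. A.2] -/
theorem conjTranspose_mul_unitary_conj_mul {A R : Matrix m m ℂ} (hR' : Rᴴ * R = 1) :
    Rᴴ * (R * A * Rᴴ) * R = A := by
  calc Rᴴ * (R * A * Rᴴ) * R = (Rᴴ * R) * A * (Rᴴ * R) := by noncomm_ring
    _ = A := by rw [hR', Matrix.one_mul, Matrix.mul_one]

/-- And back: `φ ∈ ker(RARᴴ - E₀)` ⇒ `Rᴴφ ∈ ker(A - E₀)`. [cite: Tasaki2020, App. A.2] -/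
theorem conjTranspose_mulVec_mem_groundSpace_unitary_conj [Nonempty m] {A R : Matrix m m ℂ} (hR : R * Rᴴ = 1)
    (hR' : Rᴴ * R = 1) {φ : m → ℂ} (hφ : φ ∈ (R * A * Rᴴ).groundSpace) : Rᴴ *ᵥ φ ∈ A.groundSpace := by
  have h := mulVec_mem_groundSpace_unitary_conj (A := R * A * Rᴴ) (R := Rᴴ)
    (by rw [conjTranspose_conjTranspose]; exact hR') (by rw [conjTranspose_conjTranspose]; exact hR) hφ
  rwa [conjTranspose_conjTranspose, conjTranspose_mul_unitary_conj_mul hR'] at h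

/-- **The ground space of `RARᴴ` is `R · ker(A - E₀)`.** [cite: Tasaki2020, App. A.2] -/
theorem groundSpace_unitary_conj [Nonempty m] {A R : Matrix m m ℂ} (hR : R * Rᴴ = 1) (hR' : Rᴴ * R = 1) :
    (R * A * Rᴴ).groundSpace = A.groundSpace.map (Matrix.toLin' R) := by
  apply le_antisymm
  · intro φ hφ
    refine ⟨Rᴴ *ᵥ φ, conjTranspose_mulVec_mem_groundSpace_unitary_conj hR hR' hφ, ?_⟩
    rw [Matrix.toLin'_apply, mulVec_mulVec, hR, one_mulVec]
  · rintro _ ⟨ψ, hψ, rfl⟩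
    rw [Matrix.toLin'_apply]
    exact mulVec_mem_groundSpace_unitary_conj hR hR' hψ

/-- **Unitary invariance of the ground-state degeneracy**: `dim ker(RARᴴ - E₀) = dim ker(A - E₀)`.
[cite: Tasaki2020, §2.1 and App. A.2] -/
theorem groundStateDegeneracy_unitary_conj [Nonempty m] {A R : Matrix m m ℂ} (hR : R * Rᴴ = 1)
    (hR' : Rᴴ * R = 1) : (R * A * Rᴴ).groundStateDegeneracy = A.groundStateDegeneracy := by
  rw [groundStateDegeneracy, groundStateDegeneracy, groundSpace_unitary_conj hR hR']
  have hinj : Function.Injective (Matrix.toLin' R) := by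
    intro v w hvw
    have h := congrArg (fun u => Rᴴ *ᵥ u) hvw
    simpa only [Matrix.toLin'_apply, mulVec_mulVec, hR', one_mulVec] using h
  exact (Submodule.equivMapOfInjective _ hinj _).finrank_eq.symm

/-- **A unitarily conjugated Hamiltonian has a unique ground state iff the original one has.**
[cite: Tasaki2020, §2.1 and App. A.2] -/
theorem hasUniqueGroundState_unitary_conj_iff [Nonempty m] {A R : Matrix m m ℂ} (hR : R * Rᴴ = 1)
    (hR' : Rᴴ * R = 1) : (R * A * Rᴴ).HasUniqueGroundState ↔ A.HasUniqueGroundState := by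
  rw [HasUniqueGroundState, HasUniqueGroundState, groundStateDegeneracy_unitary_conj hR hR']

end Matrix

namespace Literature.MathematicalPhysics.QuantumLattice

open SpinOperators Literature.Probability.LatticeModels

/-! ## §2 The sublattice half-turn about the `3`-axis: `H_XXZ(J,Δ) ≅ H_XXZ(-J,-Δ)` on the even torus -/

namespace XXZKT

section Rotation

variable {d : ℕ} (L : ℕ) [NeZero L]

/-- **Dyson–Lieb–Simon's sublattice rotation, XXZ form**: on the even torus `(ℤ/Lℤ)^d` there is a unitary `R`
(the half-turn about the `3`-axis on the odd sublattice) with `R H_XXZ(J,Δ) Rᴴ = H_XXZ(-J,-Δ)` — the planar couplings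
change sign, the axial coupling `JΔ` does not — and `R Sᶻ_x Rᴴ = Sᶻ_x` for every site; every spin `S = n/2`.
(The tree's `sublatticeOpZ_conj_anisotropicTorus` in B–U's frame, read through `xxzHamiltonian_torus_eq_three` and
`anisotropicTorus_eq_two_smul_three`.) [cite: DysonLiebSimon1978, §2] [cite: BjornbergUeltschi2022, Prop. 2.4] -/
theorem exists_sublatticeRotZ_conj_xxzHamiltonian (hL : Even L) (n : ℕ) (J Δ : ℝ) :
    ∃ R : Op (TorusSite d L) (n + 1), R * Rᴴ = 1 ∧ Rᴴ * R = 1 ∧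
      R * xxzHamiltonian n (torusGraph d L) J Δ * Rᴴ = xxzHamiltonian n (torusGraph d L) (-J) (-Δ) ∧
      ∀ x : TorusSite d L, R * siteSpin n x 2 * Rᴴ = siteSpin n x 2 := by
  obtain ⟨k, rfl⟩ : ∃ k, L = 2 * k := by
    obtain ⟨j, hj⟩ := hL
    exact ⟨j, by omega⟩
  obtain ⟨t, hta, htb, htx, hty, htz⟩ := exists_halfTurn_z n
  set u : TorusSite d (2 * k) → Matrix (Fin (n + 1)) (Fin (n + 1)) ℂ := fun z =>
    if (∑ j, ZMod.castHom (dvd_mul_right 2 k) (ZMod 2) (z j)) = 0 then (1 : Matrix _ _ ℂ) else t with hu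
  have hua : ∀ z, u z * (u z)ᴴ = 1 := by
    intro z; simp only [hu]; split_ifs
    · rw [conjTranspose_one, Matrix.mul_one]
    · exact hta
  have hub : ∀ z, (u z)ᴴ * u z = 1 := by
    intro z; simp only [hu]; split_ifs
    · rw [conjTranspose_one, Matrix.mul_one]
    · exact htb
  refine ⟨productOp u, productOp_mul_conjTranspose hua, productOp_conjTranspose_mul hub, ?_, fun x => ?_⟩
  · have hconj : productOp u * anisotropicTorus d (2 * k) n (-J) (-J) (-(J * Δ)) * (productOp u)ᴴ =
        anisotropicTorus d (2 * k) n (-(-J)) (-(-J)) (-(J * Δ)) :=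
      sublatticeOpZ_conj_anisotropicTorus k hta htb htx hty htz (-J) (-J) (-(J * Δ))
    rw [anisotropicTorus_eq_two_smul_three, anisotropicTorus_eq_two_smul_three, Matrix.mul_smul,
      Matrix.smul_mul] at hconj
    rw [xxzHamiltonian_torus_eq_three, xxzHamiltonian_torus_eq_three,
      show -((-J) * (-Δ)) = -(J * Δ) by ring]
    exact smul_right_injective _ (two_ne_zero (α := ℂ)) hconj
  · rw [productOp_conj_siteSpin hua, siteSpin]
    congr 1
    simp only [hu, spinVec_two]
    split_ifs
    · rw [conjTranspose_one, Matrix.mul_one, Matrix.one_mul]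
    · exact htz

variable {L} in
/-- A unitary fixing every `Sᶻ_x` fixes `Sᶻ_tot`: `R Sᶻ_tot Rᴴ = Sᶻ_tot`. [cite: DysonLiebSimon1978, §2] -/
theorem conj_totalSpin_two_of_conj_siteSpin {n : ℕ} {R : Op (TorusSite d L) (n + 1)}
    (hz : ∀ x : TorusSite d L, R * siteSpin n x 2 * Rᴴ = siteSpin n x 2) :
    R * totalSpin n 2 * Rᴴ = totalSpin n 2 := by
  rw [totalSpin, Finset.mul_sum, Finset.sum_mul]
  exact Finset.sum_congr rfl fun x _ => hz x

variable {L} in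
/-- … hence commutes with it: `Sᶻ_tot R = R Sᶻ_tot` and `Sᶻ_tot Rᴴ = Rᴴ Sᶻ_tot`. [cite: DysonLiebSimon1978, §2] -/
theorem totalSpin_two_mul_eq_of_conj_siteSpin {n : ℕ} {R : Op (TorusSite d L) (n + 1)}
    (hR' : Rᴴ * R = 1) (hz : ∀ x : TorusSite d L, R * siteSpin n x 2 * Rᴴ = siteSpin n x 2) :
    totalSpin n 2 * R = R * totalSpin n 2 ∧ totalSpin n 2 * Rᴴ = Rᴴ * totalSpin n 2 := by
  have h := conj_totalSpin_two_of_conj_siteSpin hz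
  constructor
  · calc totalSpin n 2 * R = R * totalSpin n 2 * Rᴴ * R := by rw [h]
      _ = R * totalSpin n 2 := by rw [Matrix.mul_assoc, hR', Matrix.mul_one]
  · calc totalSpin n 2 * Rᴴ = (Rᴴ * R) * totalSpin n 2 * Rᴴ := by rw [hR', Matrix.one_mul]
      _ = Rᴴ * (R * totalSpin n 2 * Rᴴ) := by noncomm_ring
      _ = Rᴴ * totalSpin n 2 := by rw [h]

/-- **Sector energies do not see the planar sign**: `E_M(H_XXZ(-J,-Δ)) = E_M(H_XXZ(J,Δ))` for every magnetisation
sector `Sᶻ_tot = M` (the rotation preserves the sectors). [cite: DysonLiebSimon1978, §2] [cite: KomaTasaki1994, §3.3] -/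
theorem lowestEnergyInSector_xxz_neg_neg (hL : Even L) (n : ℕ) (J Δ M : ℝ) :
    lowestEnergyInSector n (xxzHamiltonian n (torusGraph d L) (-J) (-Δ)) M =
      lowestEnergyInSector n (xxzHamiltonian n (torusGraph d L) J Δ) M := by
  obtain ⟨R, hR, hR', hconj, hz⟩ := exists_sublatticeRotZ_conj_xxzHamiltonian (d := d) L hL n J Δ
  obtain ⟨hc, hc'⟩ := totalSpin_two_mul_eq_of_conj_siteSpin hR' hz
  have h1 : Rᴴᴴ * Rᴴ = 1 := by rw [conjTranspose_conjTranspose]; exact hR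
  have h2 : Rᴴ * Rᴴᴴ = 1 := by rw [conjTranspose_conjTranspose]; exact hR'
  have hC : Commute Rᴴ (totalSpin (Λ := TorusSite d L) n 2) := hc'.symm
  have hC' : Commute Rᴴᴴ (totalSpin (Λ := TorusSite d L) n 2) := by
    rw [conjTranspose_conjTranspose]; exact hc.symm
  have h := Matrix.minEnergyOn_conjTranspose_mul_mul (xxzHamiltonian n (torusGraph d L) J Δ) Rᴴ
    (spinZSector (Λ := TorusSite d L) n M) h1 h2
    (fun ψ hψ => mulVec_mem_spinZSector_of_commute hC hψ)
    (fun ψ hψ => mulVec_mem_spinZSector_of_commute hC' hψ)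
  rw [conjTranspose_conjTranspose, hconj] at h
  rw [lowestEnergyInSector, lowestEnergyInSector]
  exact h

/-- **Ground energies do not see the planar sign**: `E₀(H_XXZ(-J,-Δ)) = E₀(H_XXZ(J,Δ))`.
[cite: DysonLiebSimon1978, §2] -/
theorem groundEnergy_xxz_neg_neg (hL : Even L) (n : ℕ) (J Δ : ℝ) :
    (xxzHamiltonian n (torusGraph d L) (-J) (-Δ)).groundEnergy =
      (xxzHamiltonian n (torusGraph d L) J Δ).groundEnergy := by
  obtain ⟨R, hR, -, hconj, -⟩ := exists_sublatticeRotZ_conj_xxzHamiltonian (d := d) L hL n J Δ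
  have hU : R ∈ Matrix.unitaryGroup _ ℂ :=
    Matrix.mem_unitaryGroup_iff.2 (by rw [star_eq_conjTranspose]; exact hR)
  rw [← hconj, Matrix.groundEnergy_unitary_conj hU]

/-! ### The planar-ferromagnetic, axially antiferromagnetic XXZ model `J < 0`, `Δ < 0` -/

/-- **Unique ground state for the planar-ferromagnetic sign**: for `d ≥ 1`, even `L`, every spin, `J < 0` and
`Δ < 0` (so `JΔ > 0`: ferromagnetic `SˣSˣ + SʸSʸ`, antiferromagnetic `SᶻSᶻ` — the hard-core Bose gas with
REPULSION), `xxzHamiltonian n (torusGraph d L) J Δ` has a one-dimensional ground space — the antiferromagnet's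
`hasUniqueGroundState_xxzAF` carried by the sublattice rotation. [cite: AizenmanEtAl2004, Appendix A]
[cite: KomaTasaki1994, §3.3] [cite: DysonLiebSimon1978, §2] -/
theorem hasUniqueGroundState_xxz_planarFerro (hd : 0 < d) (hL : Even L) (n : ℕ) {J Δ : ℝ} (hJ : J < 0)
    (hΔ : Δ < 0) : (xxzHamiltonian n (torusGraph d L) J Δ).HasUniqueGroundState := by
  obtain ⟨R, hR, hR', hconj, -⟩ := exists_sublatticeRotZ_conj_xxzHamiltonian (d := d) L hL n (-J) (-Δ)
  rw [neg_neg, neg_neg] at hconj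
  rw [← hconj, Matrix.hasUniqueGroundState_unitary_conj_iff hR hR']
  exact hasUniqueGroundState_xxzAF L hd hL n (neg_pos.2 hJ) (neg_pos.2 hΔ)

/-- **Its ground states lie in `Sᶻ_tot = 0`** (`J < 0`, `Δ < 0`): the rotation fixes `Sᶻ_tot`, and the
antiferromagnet's ground states are annihilated by it (`groundState_totalSpin_eq_zero_xxzAF`).
[cite: AizenmanEtAl2004, Appendix A] [cite: KomaTasaki1994, §3.2 (3.3), §3.3] -/
theorem groundState_totalSpin_eq_zero_xxz_planarFerro (hd : 0 < d) (hL : Even L) (n : ℕ) {J Δ : ℝ}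
    (hJ : J < 0) (hΔ : Δ < 0) {Φ : TensorIndex (TorusSite d L) (n + 1) → ℂ}
    (hΦ : Φ ∈ (xxzHamiltonian n (torusGraph d L) J Δ).groundSpace) : totalSpin n 2 *ᵥ Φ = 0 := by
  obtain ⟨R, hR, hR', hconj, hz⟩ := exists_sublatticeRotZ_conj_xxzHamiltonian (d := d) L hL n (-J) (-Δ)
  rw [neg_neg, neg_neg] at hconj
  rw [← hconj] at hΦ
  have hΦ' := Matrix.conjTranspose_mulVec_mem_groundSpace_unitary_conj hR hR' hΦ
  have h0 := groundState_totalSpin_eq_zero_xxzAF L hd hL n (neg_pos.2 hJ) (neg_pos.2 hΔ) hΦ'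
  obtain ⟨-, hc'⟩ := totalSpin_two_mul_eq_of_conj_siteSpin hR' hz
  have h1 : Rᴴ *ᵥ (totalSpin n 2 *ᵥ Φ) = 0 := by
    rw [mulVec_mulVec, ← hc', ← mulVec_mulVec, h0]
  calc totalSpin n 2 *ᵥ Φ = R *ᵥ (Rᴴ *ᵥ (totalSpin n 2 *ᵥ Φ)) := by rw [mulVec_mulVec, hR, one_mulVec]
    _ = 0 := by rw [h1, mulVec_zero]

/-- The ground space of the planar-ferromagnetic model lies in the sector `Sᶻ_tot = 0`.
[cite: AizenmanEtAl2004, Appendix A] -/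
theorem groundSpace_le_spinZSector_zero_xxz_planarFerro (hd : 0 < d) (hL : Even L) (n : ℕ) {J Δ : ℝ}
    (hJ : J < 0) (hΔ : Δ < 0) :
    (xxzHamiltonian n (torusGraph d L) J Δ).groundSpace ≤ spinZSector (Λ := TorusSite d L) n 0 := by
  intro ψ hψ
  rw [spinZSector, Module.End.mem_eigenspace_iff, Matrix.toLin'_apply,
    groundState_totalSpin_eq_zero_xxz_planarFerro L hd hL n hJ hΔ hψ, Complex.ofReal_zero, zero_smul]

end Rotation

section Tower

open _root_.Filter

variable {d : ℕ}

/-- **The Anderson tower for the planar-ferromagnetic sign, `-1 ≤ Δ < 0`, `J < 0`** (`d ≥ 2`, spin `n/2 ≥ ½`,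
`(d, S) ≠ (2, ½)`): `E_k(M) - E_k(0) ≤ c₃M²/N_k` for `0 < M² ≤ c₂N_k` on all large even tori `(ℤ/(2k+2)ℤ)^d` — the
antiferromagnet's `xxzAF_andersonTower_holds` at `(-J, -Δ)`, sector by sector through the rotation.
[cite: KomaTasaki1994, Corollary 2.11, §3.3] [cite: Tasaki2019Tower, Corollary 3.2] -/
theorem xxzPlanarFerro_andersonTower_holds (hd : 2 ≤ d) {n : ℕ} (hn : 1 ≤ n) (hdn : ¬ (d = 2 ∧ n = 1))
    {J Δ : ℝ} (hJ : J < 0) (hΔ0 : Δ < 0) (hΔ1 : -1 ≤ Δ) :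
    ∃ c₂ c₃ : ℝ, 0 < c₂ ∧ ∀ᶠ k : ℕ in atTop, ∀ M : ℤ, M ≠ 0 →
      (M : ℝ) ^ 2 ≤ c₂ * Fintype.card (TorusSite d (2 * k + 2)) →
        spinZSector (Λ := TorusSite d (2 * k + 2)) n (M : ℝ) ≠ ⊥ ∧
        lowestEnergyInSector n (xxzHamiltonian n (torusGraph d (2 * k + 2)) J Δ) M -
            (xxzHamiltonian n (torusGraph d (2 * k + 2)) J Δ).groundEnergy ≤
          c₃ * (M : ℝ) ^ 2 / Fintype.card (TorusSite d (2 * k + 2)) := by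
  obtain ⟨c₂, c₃, hc₂, hev⟩ :=
    xxzAF_andersonTower_holds (d := d) hd hn hdn (neg_pos.2 hJ) (neg_pos.2 hΔ0) (by linarith : -Δ ≤ 1)
  refine ⟨c₂, c₃, hc₂, ?_⟩
  filter_upwards [hev] with k hk M hM0 hM
  obtain ⟨hne, hE⟩ := hk M hM0 hM
  have hL : Even (2 * k + 2) := ⟨k + 1, by ring⟩
  refine ⟨hne, ?_⟩
  rw [← neg_neg J, ← neg_neg Δ, lowestEnergyInSector_xxz_neg_neg (2 * k + 2) hL,
    groundEnergy_xxz_neg_neg (2 * k + 2) hL]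
  exact hE

/-- The `(d, S) = (2, ½)` window: **planar-ferromagnetic spin-½ XXZ on `ℤ²`, `-0.15 ≤ Δ < 0`, `J < 0`** — the
tower unconditionally, from the antiferromagnet's certified window `xxzAF_andersonTower_spinHalf_two_holds`.
[cite: KomaTasaki1994, Corollary 2.11, §3.3] [cite: KuboKishi1988] -/
theorem xxzPlanarFerro_andersonTower_spinHalf_two_holds {J Δ : ℝ} (hJ : J < 0) (hΔ0 : Δ < 0)
    (hΔ1 : -0.15 ≤ Δ) :
    ∃ c₂ c₃ : ℝ, 0 < c₂ ∧ ∀ᶠ k : ℕ in atTop, ∀ M : ℤ, M ≠ 0 →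
      (M : ℝ) ^ 2 ≤ c₂ * Fintype.card (TorusSite 2 (2 * k + 2)) →
        spinZSector (Λ := TorusSite 2 (2 * k + 2)) 1 (M : ℝ) ≠ ⊥ ∧
        lowestEnergyInSector 1 (xxzHamiltonian 1 (torusGraph 2 (2 * k + 2)) J Δ) M -
            (xxzHamiltonian 1 (torusGraph 2 (2 * k + 2)) J Δ).groundEnergy ≤
          c₃ * (M : ℝ) ^ 2 / Fintype.card (TorusSite 2 (2 * k + 2)) := by
  obtain ⟨c₂, c₃, hc₂, hev⟩ :=
    xxzAF_andersonTower_spinHalf_two_holds (neg_pos.2 hJ) (neg_pos.2 hΔ0) (by linarith : -Δ ≤ 0.15)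
  refine ⟨c₂, c₃, hc₂, ?_⟩
  filter_upwards [hev] with k hk M hM0 hM
  obtain ⟨hne, hE⟩ := hk M hM0 hM
  have hL : Even (2 * k + 2) := ⟨k + 1, by ring⟩
  refine ⟨hne, ?_⟩
  rw [← neg_neg J, ← neg_neg Δ, lowestEnergyInSector_xxz_neg_neg (2 * k + 2) hL,
    groundEnergy_xxz_neg_neg (2 * k + 2) hL]
  exact hE

end Tower

end XXZKT

/-! ## §3 Boson language: the hard-core Bose gas with nearest-neighbour repulsion -/

namespace HardCoreBoson

section Boson

variable {d : ℕ} (L : ℕ) [NeZero L]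

/-- **THE INTERACTING HARD-CORE BOSE GAS HAS A UNIQUE GROUND STATE**: for `t > 0`, repulsion `V > 0`, on the even
torus `(ℤ/Lℤ)^d`, `d ≥ 1`, the ground space of `H = Σ_⟨xy⟩[-t(a†_xa_y + a†_ya_x) + V(n_x-½)(n_y-½)]` is
one-dimensional (the `V = 0` gas is `hasUniqueGroundState_hardCoreLatticeGas`). Matsubara–Matsuda:
`H = xxzHamiltonian 1 _ (-2t) (-V/2t)`, the planar-ferromagnetic spin-½ XXZ model with `Δ = -V/2t < 0`.
[cite: AizenmanEtAl2004, §II, Appendix A] [cite: MatsubaraMatsuda1956, §2] [cite: KomaTasaki1994, §3.3] -/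
theorem hasUniqueGroundState_hamiltonianNN (hd : 0 < d) (hL : Even L) {t V : ℝ} (ht : 0 < t) (hV : 0 < V) :
    (hamiltonianNN (d := d) L t V).HasUniqueGroundState := by
  rw [hamiltonianNN_eq_xxzHamiltonian ht.ne' V]
  exact XXZKT.hasUniqueGroundState_xxz_planarFerro L hd hL 1 (by linarith) (by rw [neg_lt_zero]; positivity)

/-- **… and it has exactly `|Λ|/2` particles**: every ground-state vector of the interacting gas satisfies
`N ψ = (|Λ|/2) ψ` (`N = Σ n_x = Sᶻ_tot + |Λ|/2`). [cite: AizenmanEtAl2004, Appendix A] [cite: KomaTasaki1994, §3.3] -/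
theorem groundState_halfFilling_hamiltonianNN (hd : 0 < d) (hL : Even L) {t V : ℝ} (ht : 0 < t) (hV : 0 < V)
    {ψ : TensorIndex (TorusSite d L) 2 → ℂ} (hψ : ψ ∈ (hamiltonianNN (d := d) L t V).groundSpace) :
    (∑ x : TorusSite d L, num x) *ᵥ ψ = ((Fintype.card (TorusSite d L) : ℂ) / 2) • ψ := by
  rw [hamiltonianNN_eq_xxzHamiltonian ht.ne' V] at hψ
  rw [sum_num_eq_totalSpin_add, add_mulVec,
    XXZKT.groundState_totalSpin_eq_zero_xxz_planarFerro L hd hL 1 (by linarith)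
      (by rw [neg_lt_zero]; positivity) hψ, zero_add, smul_mulVec, one_mulVec]

/-- **Aizenman–Lieb–Seiringer–Solovej–Yngvason's Appendix A statement for the INTERACTING gas**: unique ground
state, at half filling (`t > 0`, `V > 0`, even torus, `d ≥ 1`). [cite: AizenmanEtAl2004, Appendix A]
[cite: KomaTasaki1994, §3.3] -/
theorem alssy_groundState_hamiltonianNN (hd : 0 < d) (hL : Even L) {t V : ℝ} (ht : 0 < t) (hV : 0 < V) :
    (hamiltonianNN (d := d) L t V).HasUniqueGroundState ∧
      ∀ ψ ∈ (hamiltonianNN (d := d) L t V).groundSpace,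
        (∑ x : TorusSite d L, num x) *ᵥ ψ = ((Fintype.card (TorusSite d L) : ℂ) / 2) • ψ :=
  ⟨hasUniqueGroundState_hamiltonianNN L hd hL ht hV, fun _ hψ => groundState_halfFilling_hamiltonianNN L hd hL ht hV hψ⟩

end Boson

section BosonTower

open _root_.Filter

variable {d : ℕ}

/-- **THE ANDERSON TOWER OF THE INTERACTING HARD-CORE BOSE GAS, `d ≥ 3`, `0 < V ≤ 2t`** (Koma–Tasaki §3.3 beyond
`V = 0`: obscured `U(1)` = particle-number symmetry breaking): there are `c₂ > 0`, `c₃` such that on all large even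
tori `(ℤ/(2k+2)ℤ)^d` the lowest energy with particle number `|Λ|/2 + M` (the sector `Sᶻ_tot = M` of
`hamiltonianNN`, `N = Sᶻ_tot + |Λ|/2`) satisfies `E(|Λ|/2 + M) - E₀ ≤ c₃M²/|Λ|` whenever `0 < M² ≤ c₂|Λ|` — a tower of
charged states collapsing onto the unique, half-filled ground state. (`V ≤ 2t` is `Δ = V/2t ≤ 1`, where the tree proves
planar ground-state long-range order; the `V = 0` tower is `hardCoreBoson_andersonTower_holds`.)
[cite: KomaTasaki1994, Corollary 2.11, §3.3] [cite: Tasaki2019Tower, Corollary 3.2] [cite: MatsubaraMatsuda1956, §2] -/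
theorem andersonTower_hamiltonianNN (hd : 3 ≤ d) {t V : ℝ} (ht : 0 < t) (hV0 : 0 < V) (hV1 : V ≤ 2 * t) :
    ∃ c₂ c₃ : ℝ, 0 < c₂ ∧ ∀ᶠ k : ℕ in atTop, ∀ M : ℤ, M ≠ 0 →
      (M : ℝ) ^ 2 ≤ c₂ * Fintype.card (TorusSite d (2 * k + 2)) →
        spinZSector (Λ := TorusSite d (2 * k + 2)) 1 (M : ℝ) ≠ ⊥ ∧
        lowestEnergyInSector 1 (hamiltonianNN (d := d) (2 * k + 2) t V) M -
            (hamiltonianNN (d := d) (2 * k + 2) t V).groundEnergy ≤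
          c₃ * (M : ℝ) ^ 2 / Fintype.card (TorusSite d (2 * k + 2)) := by
  have hΔ0 : -(V / (2 * t)) < 0 := by rw [neg_lt_zero]; positivity
  have hΔ1 : -1 ≤ -(V / (2 * t)) := by
    rw [neg_le_neg_iff, div_le_one (by positivity)]
    exact hV1
  have h := XXZKT.xxzPlanarFerro_andersonTower_holds (d := d) (n := 1) (by omega) le_rfl (by omega)
    (J := -(2 * t)) (by linarith) hΔ0 hΔ1
  simp_rw [hamiltonianNN_eq_xxzHamiltonian ht.ne']
  exact h

/-- **The two-dimensional interacting gas, `0 < V ≤ 0.3t`**: the Anderson tower of the hard-core Bose gas with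
nearest-neighbour repulsion on `(ℤ/(2k+2)ℤ)²`, unconditionally, on the tree's certified superfluid window
(`superfluid_ground`; `Δ = V/2t ≤ 0.15`). [cite: KomaTasaki1994, Corollary 2.11, §3.3] [cite: KuboKishi1988]
[cite: MatsubaraMatsuda1956, §2] -/
theorem andersonTower_hamiltonianNN_two {t V : ℝ} (ht : 0 < t) (hV0 : 0 < V) (hV1 : V ≤ 0.3 * t) :
    ∃ c₂ c₃ : ℝ, 0 < c₂ ∧ ∀ᶠ k : ℕ in atTop, ∀ M : ℤ, M ≠ 0 →
      (M : ℝ) ^ 2 ≤ c₂ * Fintype.card (TorusSite 2 (2 * k + 2)) →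
        spinZSector (Λ := TorusSite 2 (2 * k + 2)) 1 (M : ℝ) ≠ ⊥ ∧
        lowestEnergyInSector 1 (hamiltonianNN (d := 2) (2 * k + 2) t V) M -
            (hamiltonianNN (d := 2) (2 * k + 2) t V).groundEnergy ≤
          c₃ * (M : ℝ) ^ 2 / Fintype.card (TorusSite 2 (2 * k + 2)) := by
  have hΔ0 : -(V / (2 * t)) < 0 := by rw [neg_lt_zero]; positivity
  have hΔ1 : -0.15 ≤ -(V / (2 * t)) := by
    rw [neg_le_neg_iff, div_le_iff₀ (by positivity)]
    norm_num at hV1 ⊢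
    linarith
  have h := XXZKT.xxzPlanarFerro_andersonTower_spinHalf_two_holds (J := -(2 * t)) (by linarith) hΔ0 hΔ1
  simp_rw [hamiltonianNN_eq_xxzHamiltonian ht.ne']
  exact h

end BosonTower

end HardCoreBoson

end Literature.MathematicalPhysics.QuantumLattice

end
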